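import Literature.AlgebraicGeometry.Resolution.Lipman1969IntersectionTheory
import Literature.AlgebraicGeometry.Resolution.Lipman1969NegativeDefinite
import Literature.AlgebraicGeometry.Resolution.Lipman1969IntersectionMultipleHolds
import Literature.AlgebraicGeometry.Resolution.ExceptionalCurvePoints
import Literature.AlgebraicGeometry.Resolution.PrimeDivisorIdeals
import Literature.AlgebraicGeometry.Resolution.RationalSurfaceSingularitiesBasic
import Summits.ResolutionOfSingularities.ResolutionOfSingularities.Theorems.HomologicalConductorNoZenoMinimalNoFirstKind
import HarnessLib

/-!
# Crux `NoZenoR` (stmt-ResolutionOfSingularities-19943), facts slot `stub_publishedSurfaceFactsW3`: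
# `(E²) < 0`, `(E²) ≤ −h⁰(E)`, `3·h⁰(𝓘_E) ≤ h⁰(𝓘_E²)`, and Lipman (27.3) «⇒» IN FULL from (27.1) + (13.1) a), d) + (14.1)

Route `ResolutionOfSingularities/HomologicalConductor` (cell decomp-res, hand leafhand-res-homologicalconduct-7 g0).
OURS: AI-written bookkeeping, weaker than expert review; nothing here is a statement of the manuscript under review
(Hironaka 2017).  SUPPORT level, counted 0.  Def-free, no new named facts; FACT-PARAMETRIC in the typed Lipman facts
`Lipman1969_13_1_a` (divisibility of `(D·E)` by `h⁰(E)`), `Lipman1969_13_1_d_rat` (`(F·E) = h⁰(E) + h⁰(F) − h⁰(E+F)`,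
rational regime), `Lipman1969_14_1` (negative definiteness) and `Lipman1969_27_1_reg_rat` (Castelnuovo contraction).

Companion of `…NoZenoMinimalNoFirstKind` (p811458: (27.1) ⇒ a MINIMAL desingularization has no exceptional curve of the
first kind, `h⁰(𝓘_η²) ≠ 3·h⁰(𝓘_η)`).  Here the NUMERICAL SHARPENING is supplied from typed facts, for every desingularization
`π : X → Spec S` of a two-dimensional normal Noetherian local domain:

* `excCurveDegree_self_neg` — `(E_η²) < 0` for every integral exceptional curve: (14.1) at the one-element family `{η}`;
* `excCurveDegree_self_le_neg_h0` — `(E_η²) ≤ −h⁰(E_η)`: `(E_η²)` is a multiple of `h⁰(E_η)` ((13.1) a)) and negative;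
* `three_mul_h0_le_h0_sq` — in the rational regime, `3·h⁰(𝓘_η) ≤ h⁰(𝓘_η²)` (dictionary (13.1) d) at `F = E = E_η`:
  `(E_η²) = 2·h⁰(𝓘_η) − h⁰(𝓘_η²)`);
* `three_mul_h0_lt_h0_sq_of_isMinimalResolution` — **Lipman (27.3) «⇒» in full**: on a MINIMAL desingularization of a
  rational surface singularity every integral exceptional curve satisfies (M) `3·h⁰(𝓘_η) < h⁰(𝓘_η²)`, from (27.1), (13.1) a),
  d), (14.1) — so the «⇒» half of the named fact `Lipman1969_27_3_rat` is a consequence of these four typed facts and tree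
  theorems; the «⇐» half (no first-kind curve ⇒ minimal, Lipman p. 277 via (4.1)) is untouched.

No crux or summit statement is proved here.
-/

noncomputable section

-- single-problem summit: the doubled namespace component `ResolutionOfSingularities` is forced
set_option linter.dupNamespace false

open CategoryTheory AlgebraicGeometry IsLocalRing
open Literature.AlgebraicGeometry.Resolution Literature.AlgebraicGeometry.Motives

universe u

namespace Summit.ResolutionOfSingularities.ResolutionOfSingularities.Theorems.NoZeno.ExcCount.MinimalNoFirstKind

variable {S : Type u} [CommRing S] [IsNoetherianRing S] [IsLocalRing S] [IsDomain S] [IsIntegrallyClosed S]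
  {X : Scheme.{u}} {π : X ⟶ Spec (.of S)}

/-- **`(E_η²) < 0`** for every integral exceptional curve `E_η` of a desingularization `π : X → Spec S` of a
two-dimensional normal Noetherian local domain: Lipman's Lemma (14.1) (negative definiteness of the intersection matrix)
at the one-element family `{η}` with the vector `y = 1`. [cite: Lipman1969, Lemma (14.1) (p. 224)] -/
theorem excCurveDegree_self_neg (h141 : Lipman1969_14_1.{u}) (h2 : ringKrullDim S = 2) [IsIntegral X]
    [IsLocallyNoetherian X] (hπ : IsResolution π) {η : X} (hη : η ∈ excCurvePoints π)
    (hc : IsEffectiveCartier (primeDivisorIdeal η)) :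
    excCurveDegree π (CartierDivisor.ofIsEffectiveCartier (primeDivisorIdeal η) hc) η < 0 := by
  have hF : ∀ x ∈ ({η} : Finset X), x ∈ excCurvePoints π := fun x hx => by
    rw [Finset.mem_singleton.1 hx]; exact hη
  have hcF : ∀ x ∈ ({η} : Finset X), IsEffectiveCartier (primeDivisorIdeal x) := fun x hx => by
    rw [Finset.mem_singleton.1 hx]; exact hc
  have hy : (fun _ : {x // x ∈ ({η} : Finset X)} => (1 : ℤ)) ≠ 0 := fun h0 =>
    one_ne_zero (congr_fun h0 ⟨η, Finset.mem_singleton_self η⟩)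
  have h := h141 S h2 X π hπ {η} hF hcF (fun _ => 1) hy
  have hsingle : ∀ (f : {x // x ∈ ({η} : Finset X)} → ℤ),
      ∑ i, f i = f ⟨η, Finset.mem_singleton_self η⟩ := fun f =>
    Fintype.sum_eq_single _ fun i hi => (hi (Subtype.ext (Finset.mem_singleton.1 i.2))).elim
  rw [hsingle] at h
  rw [hsingle] at h
  simpa using h

/-- **`(E_η²) ≤ −h⁰(E_η)`**: the self-intersection of an integral exceptional curve is a NEGATIVE ((14.1)) integer multiple
of `h⁰(E_η)` ((13.1) a)), hence at most `−h⁰(E_η)`; in particular `h⁰(E_η) = h0 π 𝓘_η` is finite and non-zero here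
(`ENat.toNat`-form: the multiple `m·h⁰` is `< 0`, so `h⁰.toNat ≥ 1`).
[cite: Lipman1969, Proposition (13.1) a) (p. 223) and Lemma (14.1) (p. 224)] -/
theorem excCurveDegree_self_le_neg_h0 (h131a : Lipman1969_13_1_a.{u}) (h141 : Lipman1969_14_1.{u})
    (h2 : ringKrullDim S = 2) [IsIntegral X] [IsLocallyNoetherian X] (hπ : IsResolution π) {η : X}
    (hη : η ∈ excCurvePoints π) (hc : IsEffectiveCartier (primeDivisorIdeal η)) :
    excCurveDegree π (CartierDivisor.ofIsEffectiveCartier (primeDivisorIdeal η) hc) η ≤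
        -((h0 π (primeDivisorIdeal η)).toNat : ℤ) ∧
      (h0 π (primeDivisorIdeal η)).toNat ≠ 0 := by
  have hneg := excCurveDegree_self_neg h141 h2 hπ hη hc
  obtain ⟨m, hm⟩ := h131a S X π hπ.isProper hπ.isRegular
    (CartierDivisor.ofIsEffectiveCartier (primeDivisorIdeal η) hc) η hη
  rw [hm] at hneg ⊢
  have hh : (0 : ℤ) ≤ ((h0 π (primeDivisorIdeal η)).toNat : ℤ) := Nat.cast_nonneg _
  have hm0 : m < 0 := by
    by_contra hm'
    exact absurd hneg (not_lt.2 (mul_nonneg (not_lt.1 hm') hh))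
  refine ⟨by nlinarith, fun h0 => ?_⟩
  rw [h0, Nat.cast_zero, mul_zero] at hneg
  exact lt_irrefl _ hneg

/-- **`3·h⁰(𝓘_η) ≤ h⁰(𝓘_η²)` on every desingularization of a RATIONAL surface singularity** — i.e. `(E_η²) ≤ −h⁰(E_η)`
read through the rational-regime dictionary (13.1) d) at `F = E = E_η`: `(E_η²) = 2·h⁰(𝓘_η) − h⁰(𝓘_η²)`
(`χ = h⁰` by (1.2) 2) and `H² = 0`).  In `ℕ∞`; `h⁰(𝓘_η)` is finite and non-zero by `excCurveDegree_self_le_neg_h0`.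
[cite: Lipman1969, Proposition (13.1) a), d) (p. 223) and Lemma (14.1) (p. 224)] -/
theorem three_mul_h0_le_h0_sq (h131a : Lipman1969_13_1_a.{u}) (h131d : Lipman1969_13_1_d_rat.{u})
    (h141 : Lipman1969_14_1.{u}) (h2 : ringKrullDim S = 2) (hS : HasRationalSingularity S)
    (hπ : IsResolution π) {η : X} (hη : η ∈ excCurvePoints π) :
    3 * h0 π (primeDivisorIdeal η) ≤ h0 π (primeDivisorIdeal η ^ 2) := by
  haveI : IsIntegral X := hπ.isIntegral_source
  haveI : IsProper π := hπ.isProper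
  haveI : IsLocallyNoetherian X := LocallyOfFiniteType.isLocallyNoetherian π
  have hc : IsEffectiveCartier (primeDivisorIdeal η) :=
    isEffectiveCartier_primeDivisorIdeal_of_isRegular hπ.isRegular (hπ.coheight_eq_one_of_mem_excCurvePoints h2 hη)
  obtain ⟨hle, hh0⟩ := excCurveDegree_self_le_neg_h0 h131a h141 h2 hπ hη hc
  rw [h131d S h2 hS X π hπ η hη η hη hc] at hle
  rw [pow_two]
  set h := (h0 π (primeDivisorIdeal η)).toNat with hhdef
  set q := (h0 π (primeDivisorIdeal η * primeDivisorIdeal η)).toNat with hqdef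
  have h3 : 3 * h ≤ q := by omega
  rcases eq_or_ne (h0 π (primeDivisorIdeal η * primeDivisorIdeal η)) ⊤ with htop | hfin
  · rw [htop]; exact le_top
  · have hfin' : h0 π (primeDivisorIdeal η) ≠ ⊤ := fun ht => hh0 (by rw [hhdef, ht, ENat.toNat_top])
    rw [← ENat.coe_toNat hfin', ← ENat.coe_toNat hfin, ← hhdef, ← hqdef]
    exact_mod_cast h3

/-- **Lipman (27.3) «⇒» IN FULL, from (27.1) + (13.1) a), d) + (14.1)**: on a MINIMAL desingularization `π : X → Spec S`
of a two-dimensional normal Noetherian local domain with a rational singularity, every integral exceptional curve `E_η`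
satisfies the criterion (M) `3·h⁰(𝓘_η) < h⁰(𝓘_η²)` (`(E_η²) + χ(E_η) < 0`): `≤` by `three_mul_h0_le_h0_sq`, `≠` by the
companion `h0_sq_ne_three_mul_of_isMinimalResolution` ((27.1): a first-kind curve would contract, against minimality).
[cite: Lipman1969, Corollary (27.3) (p. 277), Theorem (27.1) (p. 275), Proposition (13.1) (p. 223), Lemma (14.1) (p. 224)] -/
theorem three_mul_h0_lt_h0_sq_of_isMinimalResolution (h271 : Lipman1969_27_1_reg_rat.{u})
    (h131a : Lipman1969_13_1_a.{u}) (h131d : Lipman1969_13_1_d_rat.{u}) (h141 : Lipman1969_14_1.{u})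
    (h2 : ringKrullDim S = 2) (hS : HasRationalSingularity S) (hπ : IsMinimalResolution π)
    {η : X} (hη : η ∈ excCurvePoints π) :
    3 * h0 π (primeDivisorIdeal η) < h0 π (primeDivisorIdeal η ^ 2) :=
  three_mul_h0_lt_of_isMinimalResolution_of_le h271 h2 hS hπ hη
    (three_mul_h0_le_h0_sq h131a h131d h141 h2 hS hπ.1 hη)

/-- **The «⇒» half of the named fact `Lipman1969_27_3_rat`, DERIVED** from `Lipman1969_27_1_reg_rat`, `Lipman1969_13_1_a`,
`Lipman1969_13_1_d_rat`, `Lipman1969_14_1` (and tree theorems), in the binder shape of the fact: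
`IsMinimalResolution π → ∀ η ∈ excCurvePoints π, 3·h0 π 𝓘_η < h0 π (𝓘_η²)`.  (The «⇐» half is not derived here.)
[cite: Lipman1969, Corollary (27.3) (p. 277)] -/
theorem lipman_27_3_mp_of_27_1_13_1_14_1 (h271 : Lipman1969_27_1_reg_rat.{u})
    (h131a : Lipman1969_13_1_a.{u}) (h131d : Lipman1969_13_1_d_rat.{u}) (h141 : Lipman1969_14_1.{u})
    (h2 : ringKrullDim S = 2) (hS : HasRationalSingularity S) (X : Scheme.{u}) (π : X ⟶ Spec (.of S))
    (_hπ : IsResolution π) :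
    IsMinimalResolution π →
      ∀ η ∈ excCurvePoints π, 3 * h0 π (primeDivisorIdeal η) < h0 π (primeDivisorIdeal η ^ 2) :=
  fun hmin _η hη => three_mul_h0_lt_h0_sq_of_isMinimalResolution h271 h131a h131d h141 h2 hS hmin hη

/-! ## Appendix (same hand): Proposition (13.1) a) is a THEOREM of the tree (`Lipman1969_13_1_a_holds`,
`Literature/…/Lipman1969IntersectionMultipleHolds`), so the `h131a` binder above is dischargeable — primed versions. -/

/-- **`(E_η²) ≤ −h⁰(E_η)` modulo (14.1) only** ((13.1) a) supplied by the tree theorem `Lipman1969_13_1_a_holds`).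
[cite: Lipman1969, Proposition (13.1) a) (p. 223) and Lemma (14.1) (p. 224)] -/
theorem excCurveDegree_self_le_neg_h0' (h141 : Lipman1969_14_1.{u}) (h2 : ringKrullDim S = 2) [IsIntegral X]
    [IsLocallyNoetherian X] (hπ : IsResolution π) {η : X} (hη : η ∈ excCurvePoints π)
    (hc : IsEffectiveCartier (primeDivisorIdeal η)) :
    excCurveDegree π (CartierDivisor.ofIsEffectiveCartier (primeDivisorIdeal η) hc) η ≤
        -((h0 π (primeDivisorIdeal η)).toNat : ℤ) ∧
      (h0 π (primeDivisorIdeal η)).toNat ≠ 0 :=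
  excCurveDegree_self_le_neg_h0 Lipman1969_13_1_a_holds h141 h2 hπ hη hc

/-- **`3·h⁰(𝓘_η) ≤ h⁰(𝓘_η²)` on every desingularization of a rational surface singularity, modulo (13.1) d) and (14.1) only**
((13.1) a) by `Lipman1969_13_1_a_holds`). [cite: Lipman1969, Proposition (13.1) d) (p. 223) and Lemma (14.1) (p. 224)] -/
theorem three_mul_h0_le_h0_sq' (h131d : Lipman1969_13_1_d_rat.{u}) (h141 : Lipman1969_14_1.{u})
    (h2 : ringKrullDim S = 2) (hS : HasRationalSingularity S) (hπ : IsResolution π) {η : X}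
    (hη : η ∈ excCurvePoints π) :
    3 * h0 π (primeDivisorIdeal η) ≤ h0 π (primeDivisorIdeal η ^ 2) :=
  three_mul_h0_le_h0_sq Lipman1969_13_1_a_holds h131d h141 h2 hS hπ hη

/-- **Lipman (27.3) «⇒» IN FULL from (27.1) + (13.1) d) + (14.1)** ((13.1) a) by the tree theorem): on a MINIMAL
desingularization of a rational surface singularity every integral exceptional curve satisfies (M)
`3·h⁰(𝓘_η) < h⁰(𝓘_η²)`. [cite: Lipman1969, Corollary (27.3) (p. 277), Theorem (27.1) (p. 275), Lemma (14.1) (p. 224)] -/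
theorem three_mul_h0_lt_h0_sq_of_isMinimalResolution' (h271 : Lipman1969_27_1_reg_rat.{u})
    (h131d : Lipman1969_13_1_d_rat.{u}) (h141 : Lipman1969_14_1.{u})
    (h2 : ringKrullDim S = 2) (hS : HasRationalSingularity S) (hπ : IsMinimalResolution π)
    {η : X} (hη : η ∈ excCurvePoints π) :
    3 * h0 π (primeDivisorIdeal η) < h0 π (primeDivisorIdeal η ^ 2) :=
  three_mul_h0_lt_h0_sq_of_isMinimalResolution h271 Lipman1969_13_1_a_holds h131d h141 h2 hS hπ hη

/-- **The «⇒» half of `Lipman1969_27_3_rat`, DERIVED from `Lipman1969_27_1_reg_rat`, `Lipman1969_13_1_d_rat`,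
`Lipman1969_14_1`** (and tree theorems, including `Lipman1969_13_1_a_holds`), in the binder shape of the fact.
[cite: Lipman1969, Corollary (27.3) (p. 277)] -/
theorem lipman_27_3_mp_of_27_1_13_1d_14_1 (h271 : Lipman1969_27_1_reg_rat.{u})
    (h131d : Lipman1969_13_1_d_rat.{u}) (h141 : Lipman1969_14_1.{u})
    (h2 : ringKrullDim S = 2) (hS : HasRationalSingularity S) (X : Scheme.{u}) (π : X ⟶ Spec (.of S))
    (_hπ : IsResolution π) :
    IsMinimalResolution π →
      ∀ η ∈ excCurvePoints π, 3 * h0 π (primeDivisorIdeal η) < h0 π (primeDivisorIdeal η ^ 2) :=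
  fun hmin _η hη => three_mul_h0_lt_h0_sq_of_isMinimalResolution' h271 h131d h141 h2 hS hmin hη

end Summit.ResolutionOfSingularities.ResolutionOfSingularities.Theorems.NoZeno.ExcCount.MinimalNoFirstKind

end
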